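import Summits.PneNP.PneNP.Theorems.SoloInformedPadding
import Summits.PneNP.PneNP.Theorems.SoloInformedStreamingRung
import HarnessLib

/-!
# SoloInformedSlices — the slice family of sufficient hypotheses behind the streaming door (gen 6)

The kernel padding calculus (`SoloInformedPadding.lean`: `MCSP[n]` at length `2ⁿ` contains, as
blockwise-padded strings, every slice `Q(m,t) = {tt g : g on m variables, C_{B₂}(g) ≤ t}` with
`t = n ≥ m`) turns the one remaining hypothesis of the McKay–Murray–Williams door for `s = id`
(`soloInformed_pneNP_of_streamingLowerBound_id_two_le`: the conjuncts `c ≥ 2` of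
`StreamingLowerBound id` give `PneNP`; `c ≤ 1` are theorems) into a ONE-PARAMETER FAMILY of
sufficient hypotheses, one for every threshold function `t`:

* `soloInformed_pneNP_of_sliceLowerBound` — fix ANY `t : ℕ → ℕ`.  If for every `c ≥ 2` no language
  in `USTREAM[(log₂ N)^c + c]` (uniform one-pass, that much space and update/report time) agrees
  with the padded slice — i.e. contains the `2^{t(m)}`-bit blockwise padding of `tt g` exactly when
  `C_{B₂}(g) ≤ t(m)`, for all `0 < m ≤ t(m)` and all `m`-variable `g` (a PROMISE condition: nothing
  is asked on non-padded inputs) — then `PneNP`.  Informally: "uniform one-pass `poly(t)`-memory,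
  `poly(t)`-per-bit machines cannot decide `C(g) ≤ t(m)` from the (repeated) truth table of `g`",
  for one `t` of our choosing (`t = id`, `t = λm`, `t = m^k`, `t = 2^{m/2}`, …), already gives
  `P ≠ NP`.
* `soloInformed_slices_streamable_of_not_pneNP` — the width of the whole family at once: if
  `¬ PneNP` then ONE language in some `USTREAM[(log₂ N)^c + c]` (namely `MCSP[id]`) agrees with
  EVERY padded slice, for every `t` simultaneously.
* `soloInformed_pneNP_or_slices_streamable` — the dichotomy form.

Reading (paper/sharpest-statement.md §3(b), generation 6): every member of the family denies a
budget of `2^{t + O(log t)}` total time and `poly(t)` memory, one pass, for a synthesis question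
whose every known uniform algorithm is perebor, `2^{Θ(t log t)}`; no slice is thin, since
`Q(j,t) ⊆ Q(m,t)` padded for `j ≤ m` (same padding lemma).
-/

namespace Summit.PneNP.PneNP.Theorems

open Literature.Computability.Complexity Literature.Computability.MetaComplexity
open Literature.Computability.MetaComplexity.McKayMurrayWilliams2019 CodeFP

/-- **Any one slice lower bound opens the door.** For an arbitrary threshold function `t`: if for
every `c ≥ 2` no `USTREAM[(log₂ N)^c + c]` language agrees with the blockwise-padded slice
`{pad(tt g) : C_{B₂}(g) ≤ t(m)}` on padded inputs (`0 < m ≤ t(m)`), then `PneNP`.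
Proof: `MCSP[id]` itself agrees with every padded slice (`soloInformed_padded_mem_MCSPSize_id_iff`),
so the hypothesis yields the conjuncts `c ≥ 2` of `StreamingLowerBound id`. -/
theorem soloInformed_pneNP_of_sliceLowerBound (t : ℕ → ℕ)
    (h : ∀ c : ℕ, 2 ≤ c → ¬ ∃ L ∈ USTREAM (fun N => Nat.log 2 N ^ c + c)
        (fun N => Nat.log 2 N ^ c + c),
      ∀ m, 0 < m → m ≤ t m → ∀ g : (Fin m → Bool) → Bool,
        (truthTable fun u : Fin (t m - m + m) → Bool => g fun i => u (Fin.natAdd (t m - m) i)) ∈ L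
          ↔ circuitSizeOver B2 g ≤ t m) : PneNP :=
  soloInformed_pneNP_of_streamingLowerBound_id_two_le fun c hc hmem =>
    h c hc ⟨MCSPSize (fun n => n), hmem, fun m hm hmt g => by
      rw [soloInformed_padded_mem_MCSPSize_id_iff hm, Nat.sub_add_cancel hmt]⟩

/-- **Width of the whole family.** If `¬ PneNP` then a single uniform one-pass streaming language
with `(log₂ N)^c + c` space and update/report time — `MCSP[id]` — agrees with every padded slice,
for every threshold function `t` at once. [cite: McKayMurrayWilliams2019, Thm. 1.2] -/
theorem soloInformed_slices_streamable_of_not_pneNP (hP : ¬ PneNP) :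
    ∃ c : ℕ, ∃ L ∈ USTREAM (fun N => Nat.log 2 N ^ c + c) (fun N => Nat.log 2 N ^ c + c),
      ∀ t : ℕ → ℕ, ∀ m, 0 < m → m ≤ t m → ∀ g : (Fin m → Bool) → Bool,
        (truthTable fun u : Fin (t m - m + m) → Bool => g fun i => u (Fin.natAdd (t m - m) i)) ∈ L
          ↔ circuitSizeOver B2 g ≤ t m := by
  obtain ⟨c, hc⟩ := soloInformed_mcspSize_mem_USTREAM_of_not_pneNP hP (s := fun n => n)
    (((ulength unitE).comp (unitsPow 1)).congr fun n => by simp) fun n => le_rfl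
  exact ⟨c, MCSPSize (fun n => n), hc, fun t m hm hmt g => by
    rw [soloInformed_padded_mem_MCSPSize_id_iff hm, Nat.sub_add_cancel hmt]⟩

/-- **Dichotomy form of the slice family.** Either `PneNP`, or one uniform `poly(log₂ N)`-resource
one-pass streaming language decides every padded slice `C_{B₂}(g) ≤ t(m)`, all `t` at once. -/
theorem soloInformed_pneNP_or_slices_streamable :
    PneNP ∨ ∃ c : ℕ, ∃ L ∈ USTREAM (fun N => Nat.log 2 N ^ c + c) (fun N => Nat.log 2 N ^ c + c),
      ∀ t : ℕ → ℕ, ∀ m, 0 < m → m ≤ t m → ∀ g : (Fin m → Bool) → Bool,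
        (truthTable fun u : Fin (t m - m + m) → Bool => g fun i => u (Fin.natAdd (t m - m) i)) ∈ L
          ↔ circuitSizeOver B2 g ≤ t m :=
  (em PneNP).imp_right soloInformed_slices_streamable_of_not_pneNP

end Summit.PneNP.PneNP.Theorems
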